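import Summits.Ventures.HodgeRepro.Night4SecantPair

/-!
# Closer C6 of ROUTE.md §4 — ROUTE-B's density closer as named statements, and the seven-way closer theorem

Blind re-derivation cell `pub-hodge-repro`, seat `night-4` (ROUTE HARDENING for the Monday FINAL, gen 4).  Target tree
path `lean/Summits/Ventures/HodgeRepro/Night4DensityCloser.lean`.

ROUTE.md v2.89 §4 item 8: «(C6) ROUTE-B's density closer (route-2).  Density of low-degree CM points in a Weil-type
component plus a uniform degree bound per component ⇒ S4 on the component (unprinted routine lemma; the trap that one
algebraic point does not suffice by C6 though it does by C2).»  ROUTE-B.md C3 («Density + bounded degree (routine lemma,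
closes S8 per component from countably many explicit cycles).  Claim (standard, I do not have it printed — verify before
use)»): for the polarised family `π : 𝒴 → 𝒮` over a connected component `𝒮 = 𝒮(F, 2p, split)` of the moduli of abelian
varieties of split Weil type and the local system `W ⊂ R^{2p}π_*ℚ` of Weil classes, «the locus 𝒮_𝒫 ⊂ 𝒮 of s such that
some non-zero w ∈ W_s is the class of a ℚ-cycle all of whose components have Hilbert polynomial in 𝒫 is a finite union of
closed subvarieties …  Hence if CM points at which W is represented by cycles of degree ≤ D are Zariski-dense in 𝒮, then
𝒮_𝒫 = 𝒮 and S8 holds on the whole component.  …  Note the trap: the G(ℚ)-orbit of one point is dense … but transporting a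
cycle along isogenies of unbounded degree does not give a bound, so one algebraic CM point does not suffice by C3 (it does
suffice by C2).»

This file types the closer on the `RouteData` interface:

* `DensityData` — the components `𝒮`, membership `B ∈ 𝒮`, the predicate «some non-zero class of `W_F(B)` is the class of
  a `ℚ`-cycle of degree `≤ D`», and Zariski density of a set of points of a component (fields assert nothing);
* `DensityClosedLocus` — the cell's UNPRINTED routine lemma, NAMED as a hypothesis exactly as ROUTE-B states its
  consequence («if CM points at which W is represented by cycles of degree ≤ D are Zariski-dense in 𝒮, then … on the whole
  component»); `RepByAlg` — the definitional clause «a cycle class is algebraic»;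
* `Markman2025b_oneClass` — the PRINTED «one class suffices» (Markman 2025b p0003:L44–46; ROUTE.md §1 row S4, L3.6);
* `OpenDensity` — the OPEN input: for every `S4` instance, a component containing it in which the CM points represented
  by cycles of a uniform degree `D` are Zariski-dense; `S4_of_density`, `S0_of_openDensity`;
* `DensityClosersData`, `PrintedInputs₇`, `CellLemmas₇`, `OpenDensityInput`, `S0_of_any_closer₇` — the SEVEN named
  open inputs of ROUTE.md §1 / §4 in one statement (the six of `Night4SecantPair.S0_of_any_closer₆` and C6).

HONESTY.  The closed-locus lemma is the cell's (ROUTE-B: «I do not have it printed — verify before use»), carried as a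
hypothesis in `CellLemmas₇`, never asserted.  No open input is closed; `S4` and `S0 = HC_CM` remain OPEN exactly as the
route marks them.  Nothing in this file asserts anything about the status of the Hodge conjecture for CM abelian
varieties, which is NOT proved, nor anything about the original programme.
-/

set_option autoImplicit false

namespace HodgeRepro.Route

/-! ## The objects of the density closer on the route's interface -/

/-- **The data of ROUTE-B's C3** as an ABSTRACT INTERFACE over `RouteData` — nothing is constructed: the connected
components `𝒮 = 𝒮(F, 2p, split)` of the moduli of polarised abelian varieties of split Weil type relative to `F`
(Deligne LNM 900 Prop 4.1 / Cor 4.2: one component per Landherr class), the points of a component (the varieties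
`B = 𝒴_s`), the predicate «some non-zero class of `W_F(B) ⊂ H^{2p}(B, ℚ)(p)` is the class of a `ℚ`-cycle of degree `≤ D`
with respect to the polarisation» (ROUTE-B: «the class of a ℚ-cycle all of whose components have Hilbert polynomial in
𝒫», `𝒫` finite), and Zariski density of a set of points in a component. -/
structure DensityData extends RouteData where
  /-- the connected components `𝒮` of the moduli of polarised abelian varieties of split Weil type relative to `F` -/
  Comp : Type
  /-- `B` is (the fibre at) a point of the component `𝒮` -/
  inComp : Var → Comp → Prop
  /-- `RepBy p B D`: some non-zero class of `W_F(B) ⊂ H^{2p}(B, ℚ)(p)` is the class of a `ℚ`-cycle of degree `≤ D` -/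
  RepBy : ℕ → Var → ℕ → Prop
  /-- `ZariskiDense 𝒮 S`: the set `S` of points of `𝒮` is Zariski-dense in `𝒮` -/
  ZariskiDense : Comp → (Var → Prop) → Prop

variable (𝓓 : DensityData)

/-! ## The cell's routine lemma, the definitional clause, and the printed «one class suffices» -/

/-- **The cell's UNPRINTED routine lemma (ROUTE-B C3), named**: «if CM points at which W is represented by cycles of degree
≤ D are Zariski-dense in 𝒮, then 𝒮_𝒫 = 𝒮» — every point of the component is represented by a cycle of degree `≤ D`.
ROUTE-B's reason, as stated: «the locus 𝒮_𝒫 ⊂ 𝒮 … is a finite union of closed subvarieties (image of a closed condition on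
the proper relative Hilbert/Chow scheme; classes of flat families of cycles are locally constant)».  ROUTE-B: «standard, I
do not have it printed — verify before use».  A hypothesis here, nothing asserted. -/
def DensityClosedLocus : Prop :=
  ∀ (p : ℕ) (𝒮 : 𝓓.Comp) (D : ℕ),
    𝓓.ZariskiDense 𝒮 (fun B => 𝓓.inComp B 𝒮 ∧ 𝓓.IsCM B ∧ 𝓓.RepBy p B D) →
      ∀ B : 𝓓.Var, 𝓓.inComp B 𝒮 → 𝓓.RepBy p B D

/-- The definitional clause: a class represented by a `ℚ`-cycle is algebraic — `RepBy p B D` gives a non-zero class of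
`W_F(B)` in the algebraic classes (van Geemen 2.1: `alg` is the image of `Ψ : Z^p(X)_ℚ → B^p(X)`). -/
def RepByAlg : Prop :=
  ∀ (p : ℕ) (B : 𝓓.Var) (D : ℕ), 𝓓.RepBy p B D → ∃ w ∈ 𝓓.weil p B, w ≠ 0 ∧ w ∈ 𝓓.alg p B

/-- **Markman 2025b, «one class suffices»** — arXiv:2509.23079, store `paper:arxiv-2509.23079` p0003:L44–46 (re-read by the
seat 2026-08-24): "It suffices to prove the algebraicity of one non-zero class in HW(A,η), as K acts via algebraic
correspondences."  ROUTE.md §1 row S4: "Equivalent (L3.6): ONE non-zero class of W_F(B) is algebraic (F acts through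
algebraic correspondences — graphs of F ⊂ End⁰(B), divisor classes by M2 5.6)."  Typed for the route's `S4` instances:
a non-zero algebraic class in `W_F(B)` makes the whole line algebraic.  PRINTED. -/
def Markman2025b_oneClass (𝓗 : RouteData) : Prop :=
  ∀ (p : ℕ) (B : 𝓗.Var), 𝓗.SplitWeil p B → (∃ w ∈ 𝓗.weil p B, w ≠ 0 ∧ w ∈ 𝓗.alg p B) → 𝓗.weil p B ≤ 𝓗.alg p B

/-! ## The OPEN input of §4 item 8, and the closer composed with the chain -/

/-- **OPEN input (C6)** — ROUTE.md §4 item 8 as stated: for every instance `B` of `S4` there are a component `𝒮 ∋ B` and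
a UNIFORM degree bound `D` such that the CM points of `𝒮` at which `W_F` is represented by a cycle of degree `≤ D` are
Zariski-dense in `𝒮` («density of low-degree CM points in a Weil-type component plus a uniform degree bound per
component»).  ROUTE-B on what would supply it: «explicit cycles (Fermat/Shioda …, Prym/theta constructions of Schoen and
van Geemen 4.16 generalised to F of degree ≥ 4, or Remark 4.10's cycles …) at a dense set of CM points WITH A UNIFORM DEGREE
BOUND per component».  OPEN. -/
def OpenDensity : Prop :=
  ∀ (p : ℕ), 1 ≤ p → ∀ B : 𝓓.Var, 𝓓.SplitWeil p B →
    ∃ (𝒮 : 𝓓.Comp) (D : ℕ), 𝓓.inComp B 𝒮 ∧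
      𝓓.ZariskiDense 𝒮 (fun B' => 𝓓.inComp B' 𝒮 ∧ 𝓓.IsCM B' ∧ 𝓓.RepBy p B' D)

/-- **C6 closes S4**: the closed-locus lemma, the definitional clause, the printed «one class suffices» and the open
density input give `S4`. -/
theorem S4_of_density (hC : DensityClosedLocus 𝓓) (hR : RepByAlg 𝓓) (hM : Markman2025b_oneClass 𝓓.toRouteData)
    (h : OpenDensity 𝓓) : S4 𝓓.toRouteData := by
  intro p hp B hB
  obtain ⟨𝒮, D, hB𝒮, hdense⟩ := h p hp B hB
  exact hM p B hB (hR p B D (hC p 𝒮 D hdense B hB𝒮))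

/-- **C6 closes S0** through the chain of `RouteChain` (`S0 ⇐ S1 ∧ S2 ∧ S3 ∧ S4`). -/
theorem S0_of_openDensity (hpull : AlgPull 𝓓.toRouteData)
    (h123 : S1 𝓓.toRouteData ∧ S2 𝓓.toRouteData ∧ S3 𝓓.toRouteData)
    (hC : DensityClosedLocus 𝓓) (hR : RepByAlg 𝓓) (hM : Markman2025b_oneClass 𝓓.toRouteData)
    (h : OpenDensity 𝓓) : S0 𝓓.toRouteData :=
  S0_of_S1_S2_S3_S4 𝓓.toRouteData hpull ⟨h123.1, h123.2.1, h123.2.2, S4_of_density 𝓓 hC hR hM h⟩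

/-! ## Seven named open inputs in one statement -/

/-- **The merged interface**: `SecantClosersData` (the six chains of `Night4SecantPair`) together with the objects of the
density closer; overlapping fields are merged by name.  The fields assert nothing. -/
structure DensityClosersData extends SecantClosersData, DensityData

variable (𝓒 : DensityClosersData)

/-- **The PRINTED inputs of the seven chains, bundled**: those of `Night4SecantPair.PrintedInputs₆` and Markman 2025b's
«one class suffices». -/
structure PrintedInputs₇ : Prop extends PrintedInputs₆ 𝓒.toSecantClosersData where
  /-- Markman 2025b p0003:L44–46: one non-zero algebraic Weil class makes the line algebraic -/
  oneClass : Markman2025b_oneClass 𝓒.toRouteData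

/-- **The cell's UNPRINTED lemmas of the seven chains, bundled**: those of `Night4Closers.CellLemmas` and the closed-locus
lemma of ROUTE-B C3 with its definitional clause. -/
structure CellLemmas₇ : Prop extends CellLemmas 𝓒.toClosersData where
  /-- ROUTE-B C3: the represented-by-bounded-degree locus is closed -/
  closedLocus : DensityClosedLocus 𝓒.toDensityData
  /-- a cycle class is algebraic -/
  repByAlg : RepByAlg 𝓒.toDensityData

/-- **OPEN input 7 — C6**: the density input of ROUTE.md §4 item 8 (`OpenDensity`). -/
def OpenDensityInput : Prop :=
  OpenDensity 𝓒.toDensityData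

/-- **Chain 7** — the density input closes `S0`. -/
theorem S0_of_openDensityInput (hP : PrintedInputs₇ 𝓒) (hL : CellLemmas₇ 𝓒) (h : OpenDensityInput 𝓒) :
    S0 𝓒.toRouteData :=
  S0_of_openDensity 𝓒.toDensityData hP.pull ⟨hP.s1, hP.s2, hP.s3⟩ hL.closedLocus hL.repByAlg hP.oneClass h

/-- **SEVEN NAMED OPEN INPUTS IN ONE STATEMENT** — the six of `Night4SecantPair.S0_of_any_closer₆` (the faces of degree
`≥ 8`, the invariant cycles conjecture, VHC, the Lefschetz standard conjecture for the total spaces, Route C's conditional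
content, a generic secant pair per instance) and C6 (dense low-degree CM points with a uniform bound per component): `S0`
follows from the printed inputs, the cell's lemmas, and ANY ONE of them. -/
theorem S0_of_any_closer₇ (hP : PrintedInputs₇ 𝓒) (hL : CellLemmas₇ 𝓒)
    (h : OpenFrontier 𝓒.toClosersData ∨ OpenInvariantCycles 𝓒.toClosersData ∨ OpenVHC 𝓒.toClosersData ∨
      OpenLefschetz 𝓒.toClosersData ∨ OpenRouteC 𝓒.toClosersData ∨ OpenSecant 𝓒.toSecantClosersData ∨
      OpenDensityInput 𝓒) :
    S0 𝓒.toRouteData := by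
  rcases h with h | h | h | h | h | h | h
  · exact S0_of_openFrontier 𝓒.toClosersData hP.toPrintedInputs hL.toCellLemmas h
  · exact S0_of_openInvariantCycles 𝓒.toClosersData hP.toPrintedInputs hL.toCellLemmas h
  · exact S0_of_openVHC 𝓒.toClosersData hP.toPrintedInputs h
  · exact S0_of_openLefschetz 𝓒.toClosersData hP.toPrintedInputs h
  · exact S0_of_openRouteC 𝓒.toClosersData hP.toPrintedInputs h
  · exact S0_of_openSecant 𝓒.toSecantClosersData hP.toPrintedInputs₆ h
  · exact S0_of_openDensityInput 𝓒 hP hL h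

end HodgeRepro.Route
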